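import Mathlib
import Literature.NumberTheory.LFunctions.Zhang2022.Section2GammaFactor
import Literature.Analysis.Complex.BacklundTrick
import HarnessLib

/-!
# Zhang (2022), §5, proof of Lemma 5.1: the vertical shift
# `Z(s+iv,θ) = Z(s,θ)(kt/2π)^{−iv}(1 + O((|v|+A)|v|/t))`, kernel-checked

Topic `Literature/NumberTheory/LFunctions/Zhang2022` (Landau–Siegel autopsy tree; verdict-neutral).
Y. Zhang, *Discrete mean estimates and the Landau–Siegel zero*, arXiv:2211.02515v1 (2022) — **an
unrefereed manuscript, a claimed result under adjudication** (cell pub-zhang: audit + repair census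
of arXiv:2211.02515; no claim about Landau–Siegel) — §5, p. 10, proof of Lemma 5.1 (`w = u + iv`,
`u = 0`):

> Proof. We have `Z(s+w,ψ)/Z(s,ψ) = exp{∫₀^w (Z′/Z)(s+w′,ψ) dw′}`.
> Assume `|w′| ≤ |w|`. By (2.6) and the Stirling formula,
> `(Z′/Z)(s+w′,ψ) = −log p + (ϑ′/ϑ)(s+w′) + O(ε) = −log(pt/2π) + O(1/t₀)`.
> Hence `Z(s+w,ψ) = Z(s,ψ)(pt/2π)^{−w} + O(|w|/t₀)`.
> This yields (5.1) and (5.2) since `pt/2π = pt₀(1+O(ι^{−114}))`, `pt/2π = Pt₀(1+O(ι^{−68}))`.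

This file PROVES the three displayed steps for a primitive character `θ` to an arbitrary modulus
`k ≥ 1` and a vertical shift `w = iv`, with every `O`-term replaced by an explicit bound:

* `eq_mul_exp_I_mul_integral_logDeriv` — the first display: for `g` analytic and zero-free on the
  vertical segment `s + i[u,v]`, `g(s+iq) = g(s+ip)·exp(i∫_p^q (g′/g)(s+iy) dy)` (vertical twin of
  the tree's `Literature.Analysis.Complex.eq_mul_exp_integral_logDeriv'`);
* `GammaFactor.analyticAt_Zfac`, `GammaFactor.Zfac_ne_zero` — `Z(·,θ)` is analytic and zero-free
  on the upper half-plane (from the exact form (2.4), `GammaFactor.Zfac_eq`);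
* the second display is `GammaFactor.logDeriv_Zfac_eq` + `GammaFactor.norm_logDeriv_vartheta_add_log_le`
  + `GammaFactor.norm_logDerivCorr_le` of `Section2GammaFactor` (the `O(ε)` there is
  `≤ 2π/(e^{πt} − e^{−πt}) ≤ 2/t`, `two_pi_div_exp_sub_exp_le`);
* `GammaFactor.Zfac_vertical_shift` — the third display, EXACT: for `1 ≤ A`, `0 < σ ≤ A`,
  `t ≥ 4A`, `|v| ≤ t/2`,
  `Z(σ+it+iv,θ) = Z(σ+it,θ)·e^{−iv log(kt/2π)}·e^{η}`, `‖η‖ ≤ (2|v| + 4A + 10)|v|/t`;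
  `GammaFactor.norm_Zfac_vertical_shift_sub_le` — its additive form
  `‖Z(s+iv,θ) − Z(s,θ)(kt/2π)^{−iv}‖ ≤ 2‖Z(s,θ)‖(2|v|+4A+10)|v|/t` once `(2|v|+4A+10)|v|/t ≤ 1`.

The manuscript's parameters (`p`, `P`, `D`, `t₀`, `ι`, `α`, the ranges `|t − 2πt₀| < ι₁ + 2`,
`|v| < ℒ^{20}`) are NOT introduced here; (5.1)–(5.4) as printed are bookkeeping consequences of the
third display under those conventions and are not restated. Nothing about Theorems 1–2 of the
source is stated or implied; nothing here bears on the cell's verdict on (8.24).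

## References

* Y. Zhang, arXiv:2211.02515v1 (2022), §5 p. 10, Lemma 5.1 and its proof.
  [cite: Zhang2022LandauSiegel, §5 Lemma 5.1 (proof)]
* H. L. Montgomery, R. C. Vaughan, *Multiplicative Number Theory I*, CUP 2007, (10.35) and
  Thm C.1 (C.17) (Stirling for `Γ′/Γ`, the input of `norm_logDeriv_vartheta_add_log_le`).
  [cite: montgomery2007, (10.35), Thm C.1]
-/

noncomputable section

open Complex Real Filter Topology Set MeasureTheory intervalIntegral

namespace Literature.NumberTheory.LFunctions.Zhang2022

/-- **First display of the proof of Lemma 5.1** (vertical twin of the tree's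
`eq_mul_exp_integral_logDeriv'`): if `g` is analytic and non-zero at every point `s + iy`,
`y ∈ [u,v]`, then for `p, q ∈ [u,v]`, `g(s+iq) = g(s+ip)·exp(i∫_p^q (g′/g)(s+iy) dy)`.
[cite: Zhang2022LandauSiegel, §5 Lemma 5.1 (proof, first display)] -/
theorem eq_mul_exp_I_mul_integral_logDeriv {g : ℂ → ℂ} {s : ℂ} {u v p q : ℝ}
    (hg : ∀ y ∈ Icc u v, AnalyticAt ℂ g (s + y * I)) (h0 : ∀ y ∈ Icc u v, g (s + y * I) ≠ 0)
    (hp : p ∈ Icc u v) (hq : q ∈ Icc u v) :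
    g (s + q * I) = g (s + p * I) *
      Complex.exp (I * ∫ y : ℝ in p..q, deriv g (s + y * I) / g (s + y * I)) := by
  set h : ℂ → ℂ := fun w => g (s + I * w) with hh
  have hpt : ∀ x : ℝ, s + I * ((x : ℂ) + ((0 : ℝ) : ℂ) * I) = s + x * I := by
    intro x; push_cast; ring
  have hval : ∀ x : ℝ, h ((x : ℂ) + ((0 : ℝ) : ℂ) * I) = g (s + x * I) := by
    intro x; simp only [hh]; rw [hpt]
  have haff : ∀ w : ℂ, HasDerivAt (fun w : ℂ => s + I * w) I w := by
    intro w
    simpa using ((hasDerivAt_id w).const_mul I).const_add s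
  have han : ∀ x ∈ Icc u v, AnalyticAt ℂ h ((x : ℂ) + ((0 : ℝ) : ℂ) * I) := by
    intro x hx
    have h1 : AnalyticAt ℂ (fun w : ℂ => s + I * w) ((x : ℂ) + ((0 : ℝ) : ℂ) * I) := by fun_prop
    exact (hg x hx).comp_of_eq h1 (hpt x)
  have hne : ∀ x ∈ Icc u v, h ((x : ℂ) + ((0 : ℝ) : ℂ) * I) ≠ 0 := by
    intro x hx; rw [hval]; exact h0 x hx
  have hder : ∀ x ∈ Icc u v, deriv h ((x : ℂ) + ((0 : ℝ) : ℂ) * I) = I * deriv g (s + x * I) := by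
    intro x hx
    have hgd : HasDerivAt g (deriv g (s + x * I)) (s + I * ((x : ℂ) + ((0 : ℝ) : ℂ) * I)) := by
      rw [hpt]; exact (hg x hx).differentiableAt.hasDerivAt
    have hc : HasDerivAt h (deriv g (s + x * I) * I) ((x : ℂ) + ((0 : ℝ) : ℂ) * I) :=
      hgd.comp ((x : ℂ) + ((0 : ℝ) : ℂ) * I) (haff _)
    rw [hc.deriv, mul_comm]
  have key := Literature.Analysis.Complex.eq_mul_exp_integral_logDeriv' (h := h) (y := 0)
    han hne hp hq
  have hint : ∫ x in p..q, deriv h ((x : ℂ) + ((0 : ℝ) : ℂ) * I) / h ((x : ℂ) + ((0 : ℝ) : ℂ) * I)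
      = I * ∫ y in p..q, deriv g (s + y * I) / g (s + y * I) := by
    rw [← intervalIntegral.integral_const_mul]
    refine intervalIntegral.integral_congr (fun x hx => ?_)
    have hx' : x ∈ Icc u v := by
      rcases le_total p q with hpq | hqp
      · rw [uIcc_of_le hpq] at hx; exact ⟨hp.1.trans hx.1, hx.2.trans hq.2⟩
      · rw [uIcc_of_ge hqp] at hx; exact ⟨hq.1.trans hx.1, hx.2.trans hp.2⟩
    show deriv h ((x : ℂ) + ((0 : ℝ) : ℂ) * I) / h ((x : ℂ) + ((0 : ℝ) : ℂ) * I)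
      = I * (deriv g (s + x * I) / g (s + x * I))
    rw [hder x hx', hval, mul_div_assoc]
  rw [hval, hval, hint] at key
  exact key

/-- `2π/(e^{πT} − e^{−πT}) ≤ 2/T` for `T ≥ 1` (the size of the `O(ε)` correction in the second
display of the proof of Lemma 5.1). [folklore] -/
theorem two_pi_div_exp_sub_exp_le {T : ℝ} (hT : 1 ≤ T) :
    2 * π / (Real.exp (π * T) - Real.exp (-π * T)) ≤ 2 / T := by
  have hT0 : 0 < T := by linarith
  have h1 : π * T + 1 ≤ Real.exp (π * T) := Real.add_one_le_exp _
  have h2 : Real.exp (-π * T) ≤ 1 / 3 := GammaFactor.exp_neg_pi_mul_le hT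
  have hπT : 0 < π * T := by positivity
  have hD : π * T ≤ Real.exp (π * T) - Real.exp (-π * T) := by linarith
  rw [div_le_div_iff₀ (lt_of_lt_of_le hπT hD) hT0]
  nlinarith [Real.pi_pos]

namespace GammaFactor

variable {k : ℕ} [NeZero k]

/-- Near a point of the upper half-plane, `Z(·,θ)` IS the product (2.4) (exact form `Zfac_eq`).
[cite: Zhang2022LandauSiegel, §2 (2.4)] -/
theorem Zfac_eventuallyEq (θ : DirichletCharacter ℂ k) {s : ℂ} (hs : 0 < s.im) :
    Zfac θ =ᶠ[𝓝 s] fun z => (θ (-1) * tau θ) * (((k : ℂ) ^ (-z) * vartheta z) * (1 + corr θ z)) := by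
  have ho : IsOpen {z : ℂ | 0 < z.im} := isOpen_lt continuous_const Complex.continuous_im
  filter_upwards [ho.mem_nhds hs] with z hz
  rw [Zfac_eq θ hz]
  ring

omit [NeZero k] in
/-- The correction factor `1 + r` of (2.4) is differentiable on the upper half-plane. [folklore] -/
theorem differentiableAt_one_add_corr (θ : DirichletCharacter ℂ k) {s : ℂ} (hs : 0 < s.im) :
    DifferentiableAt ℂ (fun z => 1 + corr θ z) s := by
  by_cases hev : θ.Even
  · have : (fun z => 1 + corr θ z) = fun _ => (1 : ℂ) := by
      funext z; rw [corr, if_pos hev, add_zero]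
    rw [this]
    exact differentiableAt_const _
  · have : (fun z => 1 + corr θ z)
        = fun z => I * (Complex.cos (π * z / 2) / Complex.sin (π * z / 2)) := by
      funext z; rw [corr, if_neg hev]; ring
    rw [this]
    have h1 : HasDerivAt (fun z : ℂ => π * z / 2) (π / 2) s := by
      simpa using ((hasDerivAt_id s).const_mul (π : ℂ)).div_const 2
    have hc : DifferentiableAt ℂ (fun z : ℂ => Complex.cos (π * z / 2)) s := by
      exact ((Complex.hasDerivAt_cos (π * s / 2)).comp s h1).differentiableAt
    have hs' : DifferentiableAt ℂ (fun z : ℂ => Complex.sin (π * z / 2)) s := by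
      exact ((Complex.hasDerivAt_sin (π * s / 2)).comp s h1).differentiableAt
    have hq : DifferentiableAt ℂ
        (fun z : ℂ => Complex.cos (π * z / 2) / Complex.sin (π * z / 2)) s :=
      hc.div hs' (sin_ne_zero_of_im_pos hs)
    exact (differentiableAt_const I).mul hq

/-- `Z(·,θ)` is differentiable on the upper half-plane. [folklore] -/
theorem differentiableAt_Zfac (θ : DirichletCharacter ℂ k) {s : ℂ} (hs : 0 < s.im) :
    DifferentiableAt ℂ (Zfac θ) s := by
  have hk : (k : ℂ) ≠ 0 := Nat.cast_ne_zero.mpr (NeZero.ne k)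
  have hkd : DifferentiableAt ℂ (fun z : ℂ => (k : ℂ) ^ (-z)) s :=
    ((hasStrictDerivAt_const_cpow (Or.inl hk)).hasDerivAt.comp s (hasDerivAt_neg s)).differentiableAt
  have hϑd : DifferentiableAt ℂ vartheta s := differentiableAt_vartheta hs.ne'
  have hprod : DifferentiableAt ℂ
      (fun z => (θ (-1) * tau θ) * (((k : ℂ) ^ (-z) * vartheta z) * (1 + corr θ z))) s :=
    (differentiableAt_const _).mul ((hkd.mul hϑd).mul (differentiableAt_one_add_corr θ hs))
  exact (Zfac_eventuallyEq θ hs).differentiableAt_iff.mpr hprod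

/-- `Z(·,θ)` is analytic on the upper half-plane. [folklore] -/
theorem analyticAt_Zfac (θ : DirichletCharacter ℂ k) {s : ℂ} (hs : 0 < s.im) :
    AnalyticAt ℂ (Zfac θ) s := by
  have ho : IsOpen {z : ℂ | 0 < z.im} := isOpen_lt continuous_const Complex.continuous_im
  have hd : DifferentiableOn ℂ (Zfac θ) {z : ℂ | 0 < z.im} := fun z hz =>
    (differentiableAt_Zfac θ hz).differentiableWithinAt
  exact hd.analyticAt (ho.mem_nhds hs)

/-- `Z(s,θ) ≠ 0` on the upper half-plane, for primitive `θ` (so that `τ(θ) ≠ 0`). [folklore] -/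
theorem Zfac_ne_zero {θ : DirichletCharacter ℂ k} (hθ : θ.IsPrimitive) {s : ℂ} (hs : 0 < s.im) :
    Zfac θ s ≠ 0 := by
  have hk : (k : ℂ) ≠ 0 := Nat.cast_ne_zero.mpr (NeZero.ne k)
  have h1 : θ (-1) ≠ 0 := by
    intro h0
    have hsq : θ (-1) * θ (-1) = 1 := by rw [← map_mul, neg_mul_neg, one_mul, map_one]
    rw [h0, zero_mul] at hsq
    exact zero_ne_one hsq
  have hkpow : (k : ℂ) ^ (-s) ≠ 0 := by
    rw [Ne, cpow_eq_zero_iff, not_and_or]; exact Or.inl hk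
  rw [Zfac_eq θ hs]
  exact mul_ne_zero (mul_ne_zero (mul_ne_zero (mul_ne_zero h1 (tau_ne_zero hθ)) hkpow)
    (vartheta_ne_zero (ChiStirling.sin_pi_mul_ne_zero hs.ne'))) (one_add_corr_ne_zero θ hs)

/-- **Lemma 5.1, third display, made exact** ("`Z(s+w,ψ) = Z(s,ψ)(pt/2π)^{−w} + O(|w|/t₀)`", for
`w = iv`): for a primitive `θ` mod `k`, `1 ≤ A`, `s = σ+it` with `0 < σ ≤ A`, `t ≥ 4A` and
`|v| ≤ t/2`,
`Z(s+iv,θ) = Z(s,θ)·e^{−iv·log(kt/2π)}·e^{η}` with `‖η‖ ≤ (2|v| + 4A + 10)|v|/t`.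
Here `η = i∫₀^v [(Z′/Z)(s+iy,θ) + log(kt/2π)] dy` and the integrand is bounded pointwise by
`|log(1+y/t)| + (2A+3)/(t+y) + 2/(t+y) ≤ (2|v|+4A+10)/t` (second display: `logDeriv_Zfac_eq`,
`norm_logDeriv_vartheta_add_log_le`, `norm_logDerivCorr_le`).
[cite: Zhang2022LandauSiegel, §5 Lemma 5.1 (proof, third display)] -/
theorem Zfac_vertical_shift {θ : DirichletCharacter ℂ k} (hθ : θ.IsPrimitive) {A σ t v : ℝ}
    (hA : 1 ≤ A) (hσ0 : 0 < σ) (hσA : σ ≤ A) (ht : 4 * A ≤ t) (hv : |v| ≤ t / 2) :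
    ∃ η : ℂ, ‖η‖ ≤ (2 * |v| + 4 * A + 10) * |v| / t ∧
      Zfac θ ((σ : ℂ) + t * I + v * I)
        = Zfac θ ((σ : ℂ) + t * I)
          * cexp (-((v : ℂ) * ((Real.log ((k : ℝ) * t / (2 * π)) : ℝ) : ℂ)) * I) * cexp η := by
  have ht0 : 0 < t := by linarith
  have hk0 : (0 : ℝ) < k := Nat.cast_pos.mpr (Nat.pos_of_ne_zero (NeZero.ne k))
  set s : ℂ := (σ : ℂ) + t * I with hs_def
  have him : ∀ y : ℝ, (s + y * I).im = t + y := by intro y; simp [hs_def]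
  have hyv : ∀ y : ℝ, |y| ≤ |v| → t / 2 ≤ t + y := by
    intro y hy; linarith [neg_abs_le y]
  have hpos : ∀ y : ℝ, |y| ≤ |v| → 0 < (s + y * I).im := by
    intro y hy; rw [him]; linarith [hyv y hy]
  have hIcc : ∀ y ∈ Icc (min 0 v) (max 0 v), |y| ≤ |v| := by
    intro y hy
    rcases le_total 0 v with h0v | hv0
    · rw [min_eq_left h0v, max_eq_right h0v] at hy
      rw [abs_of_nonneg hy.1, abs_of_nonneg h0v]; exact hy.2
    · rw [min_eq_right hv0, max_eq_left hv0] at hy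
      rw [abs_of_nonpos hy.2, abs_of_nonpos hv0]; linarith [hy.1]
  have hIoc : ∀ y ∈ Set.uIoc (0:ℝ) v, |y| ≤ |v| := by
    intro y hy
    rw [Set.uIoc, Set.mem_Ioc] at hy
    exact hIcc y ⟨hy.1.le, hy.2⟩
  have han : ∀ y ∈ Icc (min 0 v) (max 0 v), AnalyticAt ℂ (Zfac θ) (s + y * I) :=
    fun y hy => analyticAt_Zfac θ (hpos y (hIcc y hy))
  have hne : ∀ y ∈ Icc (min 0 v) (max 0 v), Zfac θ (s + y * I) ≠ 0 :=
    fun y hy => Zfac_ne_zero hθ (hpos y (hIcc y hy))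
  have h0mem : (0:ℝ) ∈ Icc (min 0 v) (max 0 v) := ⟨min_le_left _ _, le_max_left _ _⟩
  have hvmem : v ∈ Icc (min 0 v) (max 0 v) := ⟨min_le_right _ _, le_max_right _ _⟩
  -- first display
  have key := eq_mul_exp_I_mul_integral_logDeriv han hne h0mem hvmem
  have hs0 : s + ((0:ℝ) : ℂ) * I = s := by simp
  rw [hs0] at key
  -- the integrand and the main term
  set f : ℝ → ℂ := fun y => deriv (Zfac θ) (s + y * I) / Zfac θ (s + y * I) with hf_def
  set L : ℂ := ((Real.log ((k : ℝ) * t / (2 * π)) : ℝ) : ℂ) with hL_def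
  -- continuity ⇒ integrability of `f` on the segment
  have hcont : ContinuousOn f (uIcc 0 v) := by
    rw [hf_def]
    intro y hy
    have hy' : y ∈ Icc (min 0 v) (max 0 v) := by
      rcases le_total 0 v with h | h
      · rw [uIcc_of_le h] at hy; rwa [min_eq_left h, max_eq_right h]
      · rw [uIcc_of_ge h] at hy; rwa [min_eq_right h, max_eq_left h]
    have haff : ContinuousAt (fun y : ℝ => s + (y : ℂ) * I) y := by fun_prop
    have hAy := han y hy'
    have h1 : ContinuousAt (fun y : ℝ => deriv (Zfac θ) (s + (y : ℂ) * I)) y :=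
      hAy.deriv.continuousAt.comp_of_eq haff rfl
    have h2 : ContinuousAt (fun y : ℝ => Zfac θ (s + (y : ℂ) * I)) y :=
      hAy.continuousAt.comp_of_eq haff rfl
    exact (h1.div h2 (hne y hy')).continuousWithinAt
  have hii : IntervalIntegrable f volume 0 v := hcont.intervalIntegrable
  -- second display: pointwise bound on `f + L` along the segment
  have hRb : ∀ y : ℝ, |y| ≤ |v| → ‖f y + L‖ ≤ (2 * |v| + 4 * A + 10) / t := by
    intro y hy
    have hT := hyv y hy
    have hty : 0 < t + y := by linarith
    have hty1 : 1 ≤ t + y := by linarith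
    have h2A : 2 * A ≤ t + y := by linarith
    have hposy := hpos y hy
    have hld : f y = logDeriv (Zfac θ) (s + y * I) := by
      simp only [hf_def, logDeriv_apply]
    have hZ := logDeriv_Zfac_eq hθ hposy
    have hpt : (σ : ℂ) + ((t + y : ℝ) : ℂ) * I = s + y * I := by
      rw [hs_def]; push_cast; ring
    -- Stirling for `ϑ′/ϑ` (the tree's `norm_logDeriv_rsChi_add_log_le`, MV (10.35)/(C.17))
    have hϑy := norm_logDeriv_vartheta_add_log_le hA hσ0 hσA h2A
    rw [hpt] at hϑy
    have hE : ‖logDerivCorr θ (s + y * I)‖ ≤ 2 / (t + y) := by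
      refine (norm_logDerivCorr_le θ hposy).trans ?_
      rw [him]
      exact two_pi_div_exp_sub_exp_le hty1
    have hlog : -Real.log k - Real.log ((t + y) / (2 * π)) + Real.log ((k : ℝ) * t / (2 * π))
        = -Real.log (1 + y / t) := by
      have h2π : (0:ℝ) < 2 * π := by positivity
      rw [Real.log_div hty.ne' h2π.ne', Real.log_div (mul_pos hk0 ht0).ne' h2π.ne',
        Real.log_mul hk0.ne' ht0.ne', show 1 + y / t = (t + y) / t by rw [add_div, div_self ht0.ne'],
        Real.log_div hty.ne' ht0.ne']
      ring
    have hlogC : -((Real.log k : ℝ) : ℂ) - ((Real.log ((t + y) / (2 * π)) : ℝ) : ℂ) + L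
        = -((Real.log (1 + y / t) : ℝ) : ℂ) := by
      have := congrArg (fun r : ℝ => (r : ℂ)) hlog
      simpa only [Complex.ofReal_add, Complex.ofReal_sub, Complex.ofReal_neg, hL_def] using this
    have hdecomp : f y + L
        = (logDeriv vartheta (s + y * I) + ((Real.log ((t + y) / (2 * π)) : ℝ) : ℂ))
          + logDerivCorr θ (s + y * I) + (-((Real.log (1 + y / t) : ℝ) : ℂ)) := by
      rw [← hlogC, hld, hZ]; ring
    have hℓ : ‖(-((Real.log (1 + y / t) : ℝ) : ℂ))‖ ≤ 2 * |v| / t := by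
      rw [norm_neg, Complex.norm_real, Real.norm_eq_abs]
      have hut : |y / t| ≤ 1 / 2 := by
        rw [abs_div, abs_of_pos ht0, div_le_iff₀ ht0]; linarith
      -- `|log(1+u)| ≤ |u|/(1−|u|) ≤ 2|u|` for `|u| ≤ ½` (Mathlib's `abs_log_sub_add_sum_range_le`)
      have hlt : |(-(y / t))| < 1 := by rw [abs_neg]; linarith
      have hm := Real.abs_log_sub_add_sum_range_le hlt 0
      simp only [Finset.sum_range_zero, zero_add, sub_neg_eq_add, abs_neg, pow_one] at hm
      have h2u : |y / t| / (1 - |y / t|) ≤ 2 * |y / t| := by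
        rw [div_le_iff₀ (by linarith)]
        nlinarith [mul_nonneg (abs_nonneg (y / t)) (by linarith : (0:ℝ) ≤ 1 / 2 - |y / t|)]
      refine (hm.trans h2u).trans ?_
      rw [abs_div, abs_of_pos ht0, ← mul_div_assoc]
      gcongr
    have h1 : (2 * A + 3) / (t + y) + 2 / (t + y) ≤ (4 * A + 10) / t := by
      rw [← add_div, div_le_div_iff₀ hty ht0]
      nlinarith [mul_nonneg (by linarith : (0:ℝ) ≤ 2 * A + 5) (by linarith : (0:ℝ) ≤ 2 * (t + y) - t)]
    calc ‖f y + L‖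
        ≤ ‖logDeriv vartheta (s + y * I) + ((Real.log ((t + y) / (2 * π)) : ℝ) : ℂ)‖
          + ‖logDerivCorr θ (s + y * I)‖ + ‖(-((Real.log (1 + y / t) : ℝ) : ℂ))‖ := by
          rw [hdecomp]; exact norm_add₃_le
      _ ≤ (2 * A + 3) / (t + y) + 2 / (t + y) + 2 * |v| / t :=
          add_le_add (add_le_add hϑy hE) hℓ
      _ ≤ (2 * |v| + 4 * A + 10) / t := by
          rw [show (2 * |v| + 4 * A + 10) / t = (4 * A + 10) / t + 2 * |v| / t by ring]
          linarith
  -- third display: split off the main term `−iv·log(kt/2π)` and bound the rest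
  have hsplit : ∫ y in (0:ℝ)..v, f y = (∫ y in (0:ℝ)..v, (f y + L)) - v * L := by
    rw [intervalIntegral.integral_add hii intervalIntegrable_const,
      intervalIntegral.integral_const, sub_zero, Complex.real_smul]
    ring
  refine ⟨I * ∫ y in (0:ℝ)..v, (f y + L), ?_, ?_⟩
  · rw [norm_mul, Complex.norm_I, one_mul]
    have hb := intervalIntegral.norm_integral_le_of_norm_le_const (a := (0:ℝ)) (b := v)
      (f := fun y => f y + L) (C := (2 * |v| + 4 * A + 10) / t) (fun y hy => hRb y (hIoc y hy))
    rw [sub_zero] at hb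
    calc ‖∫ y in (0:ℝ)..v, f y + L‖ ≤ (2 * |v| + 4 * A + 10) / t * |v| := hb
      _ = (2 * |v| + 4 * A + 10) * |v| / t := by ring
  · rw [key, hsplit]
    have : I * ((∫ y in (0:ℝ)..v, (f y + L)) - v * L)
        = -(v * L) * I + I * ∫ y in (0:ℝ)..v, (f y + L) := by ring
    rw [this, Complex.exp_add]
    ring

/-- **Lemma 5.1, third display, additive form** ("`Z(s+w,ψ) = Z(s,ψ)(pt/2π)^{−w} + O(|w|/t₀)`"):
under the hypotheses of `Zfac_vertical_shift` and `(2|v|+4A+10)|v|/t ≤ 1`,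
`‖Z(s+iv,θ) − Z(s,θ)·e^{−iv·log(kt/2π)}‖ ≤ 2‖Z(s,θ)‖·(2|v|+4A+10)|v|/t`.
[cite: Zhang2022LandauSiegel, §5 Lemma 5.1 (proof, third display)] -/
theorem norm_Zfac_vertical_shift_sub_le {θ : DirichletCharacter ℂ k} (hθ : θ.IsPrimitive)
    {A σ t v : ℝ} (hA : 1 ≤ A) (hσ0 : 0 < σ) (hσA : σ ≤ A) (ht : 4 * A ≤ t) (hv : |v| ≤ t / 2)
    (hsmall : (2 * |v| + 4 * A + 10) * |v| / t ≤ 1) :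
    ‖Zfac θ ((σ : ℂ) + t * I + v * I)
        - Zfac θ ((σ : ℂ) + t * I)
          * cexp (-((v : ℂ) * ((Real.log ((k : ℝ) * t / (2 * π)) : ℝ) : ℂ)) * I)‖
      ≤ 2 * ‖Zfac θ ((σ : ℂ) + t * I)‖ * ((2 * |v| + 4 * A + 10) * |v| / t) := by
  obtain ⟨η, hη, hZ⟩ := Zfac_vertical_shift hθ hA hσ0 hσA ht hv
  rw [hZ]
  set Z : ℂ := Zfac θ ((σ : ℂ) + t * I)
  set e : ℂ := cexp (-((v : ℂ) * ((Real.log ((k : ℝ) * t / (2 * π)) : ℝ) : ℂ)) * I) with he_def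
  have he : ‖e‖ = 1 := by
    have : -((v : ℂ) * ((Real.log ((k : ℝ) * t / (2 * π)) : ℝ) : ℂ)) * I
        = ((-(v * Real.log ((k : ℝ) * t / (2 * π))) : ℝ) : ℂ) * I := by push_cast; ring
    rw [he_def, this, Complex.norm_exp_ofReal_mul_I]
  have h1 : ‖η‖ ≤ 1 := hη.trans hsmall
  calc ‖Z * e * cexp η - Z * e‖ = ‖Z * e * (cexp η - 1)‖ := by congr 1; ring
    _ = ‖Z‖ * ‖e‖ * ‖cexp η - 1‖ := by rw [norm_mul, norm_mul]
    _ ≤ ‖Z‖ * 1 * (2 * ‖η‖) := by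
        rw [he]; gcongr; exact Complex.norm_exp_sub_one_le h1
    _ = 2 * ‖Z‖ * ‖η‖ := by ring
    _ ≤ 2 * ‖Z‖ * ((2 * |v| + 4 * A + 10) * |v| / t) := by gcongr

end GammaFactor

end Literature.NumberTheory.LFunctions.Zhang2022
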